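import Summits.BirchSwinnertonDyer.BirchSwinnertonDyer.Theorems.ManinLocalTwoThreeNotTrivialEisensteinOdd
import Summits.BirchSwinnertonDyer.Rank1Residual.ManinAdditive.NotTrivialEisensteinLocalisationThree
import Literature.NumberTheory.EllipticCurves.SerreOpenImageDeterminantProofs
import HarnessLib

/-!
# E-es-40₃ `NotTrivialEisensteinModThreeOfIrreducible` is a THEOREM: primes `r ≡ 1 (mod 3^M)` with
# `a_r(W) ≢ r + 1 (mod 3)` when `W[3]` is irreducible (Chebotarev in `ℚ(W[3^{M+1}])`)

Summit `BirchSwinnertonDyer`, route `ManinLocalTwoThree` (cell bsd-f2-manin), crux C3 `ManinPrimeToThreeAtNine`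
(stmt-BirchSwinnertonDyer-22968).  es's law **E-es-40₃** `KatoCurve.NotTrivialEisensteinModThreeOfIrreducible`
(`…ManinAdditive.NotTrivialEisensteinLocalisationThree`, es g19 MEMO-es §32, typer g13; «THEOREM-candidate by Chebotarev»;
binder `h40` of the PROVED edges `threeAdicUnitWitness_noMuThree_of_laws` / `threeAdicUnitWitnessOfNoRationalThreeTorsion_of_hNT_laws`
towards E-es-61, the RES₃ habitat of C3) is PROVED here, as the `p = 3` twin of the tree's E-es-40₂
(`ManinLocalTwoThreeNotTrivialEisensteinAtTwo`, followed step by step; the prime-`p` plumbing is `ManinLocalTwoThreeNotTrivialEisensteinOdd`'s):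

* §1 `smul_ne_self_of_pow_three`, `pow_three_pow_smul_ne_self` — on an elementary abelian `3`-group CUBING preserves
  fixed-point-freeness (`(τ − 1)³ = τ³ − 1` in characteristic `3`), hence so does `τ ↦ τ^{3^j}`.
* §2 `sq_mulVec_ne_of_det_eq_neg_one` — over `𝔽₃` a `2 × 2` matrix of determinant `−1` without eigenvalue `1` has a fixed-point-free
  square (no eigenvalue `±1`; `decide` on residues).  §3 `pow_prime_pow_modEq_one` — `a ≡ 1 (p) ⟹ a^{p^M} ≡ 1 (p^{M+1})`.
* §4 `exists_prime_modEq_one_not_three_dvd_reductionPointCount` — for `W` globally minimal with `W[3]` irreducible, `S` finite,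
  `M`: a good prime `ℓ ∉ S`, `ℓ ≠ 3`, `ℓ ≡ 1 (mod 3^{M+1})`, with `3 ∤ #W̃(𝔽_ℓ)`.  Irreducibility gives `τ ∈ Γ_ℚ` fixed-point-free
  on `W[3]` (`not_irreducible_of_forall_exists_smul_eq`).  NEW AT `3`: the power `σ = τ^k` that fixes a primitive `3^{M+1}`-th
  root of unity `ζ ∈ ℚ(W[3^{M+1}])` (`exists_isPrimitiveRoot_fixed`, `exists_geomTorsion_exactOrder_prime`) must stay
  fixed-point-free on `W[3]`, and `φ(3^{M+1}) = 2·3^M` is EVEN.  Read `τ` in a frame `W[3] ≅ 𝔽₃²` with `det ρ̄₃ = χ̄₃` (tree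
  `exists_frame_galoisRepTorsion_rat`, Serre 1972 §5.2): if `det ρ̄₃(τ) = 1` then `τ` fixes `μ₃` (`modPCyclotomicCharacterZMod_spec`),
  so `τζ = ζ^a` with `a ≡ 1 (mod 3)`, `a^{3^M} ≡ 1 (mod 3^{M+1})` (§3) and `k = 3^M` works (§1); if `det ρ̄₃(τ) = −1` then `τ²` is
  fixed-point-free (§2) and `k = 2·3^M` works (Euler).  Then Chebotarev (`chebotarev_geomTorsion_holds`) gives a good `ℓ ∉ S ∪ {3}`
  whose Frobenius acts on `W[3^{M+1}]` as `σ`: it fixes `ζ`, so `ζ^ℓ = ζ` (`frob_smul_eq_pow_of_pow_eq_one_prime`) and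
  `ℓ ≡ 1 (mod 3^{M+1})`; it is fixed-point-free on `W[3]`, so `3 ∤ #W̃(𝔽_ℓ)` (`exists_frobenius_smul_eq_of_dvd_reductionPointCount_holds`).
* §5 **`notTrivialEisensteinModThreeOfIrreducible_holds : NotTrivialEisensteinModThreeOfIrreducible`** (reduction to a global
  minimal model as in E-es-40₂: `hasGlobalMinimalModel_rat_holds`, `LFunction_smul`, `hasIrreducibleModPGaloisRep_smul_iff`,
  `LFunction_apply_prime_eq_frobeniusTrace`, `dvd_frobeniusTrace_sub_iff`), and the binder-free form of es's EDGE 2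
  `threeAdicUnitWitness_noMuThree_of_laws'` (E-es-61's generic cut ⟸ E-es-69, 69♮, 69♯ alone).

Axioms `propext`, `Classical.choice`, `Quot.sound`; no new definitions.  Nothing about BSD or Manin's conjecture is proved here
(E-es-69/69♮/69♯ and C3 stay OPEN).  References: J. Tate, *Global class field theory* (Cassels–Fröhlich 1967) §2.4, §3.4;
J.-P. Serre, Invent. Math. 15 (1972) §4–§5; J. H. Silverman, *AEC* III.6.4, III.8, VII.3.1; HOME/MEMO-es.md §32 (E-es-40₃).
-/

set_option autoImplicit false
set_option linter.dupNamespace false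

noncomputable section

open scoped Classical Matrix

open NumberField IsDedekindDomain Field WeierstrassCurve
  Literature.NumberTheory.EllipticCurves Literature.NumberTheory.GaloisRepresentations
  Summit.BirchSwinnertonDyer.Rank1Residual.ManinAdditive
  Summit.BirchSwinnertonDyer.Rank1Residual.ManinAdditive.KatoCurve

namespace Summit.BirchSwinnertonDyer.BirchSwinnertonDyer.Theorems.ManinLocalTwoThree

/-! ### §1  Fixed-point-free automorphisms of elementary abelian `3`-groups -/

section ThreeTorsion

variable {G A : Type*} [Group G] [AddCommGroup A] [DistribMulAction G A]

/-- **Cubing preserves fixed-point-freeness on an elementary abelian `3`-group**: if every `a` has `a + a + a = 0` and `τ`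
fixes no non-zero element, then neither does `τ³` — for `τ³a = a` the element `a + τa + τ²a` is fixed, hence `0`, and then
`τa − a` is fixed (`τ²a − τa = τa − a` is `a + τa + τ²a = 3τa = 0`), hence `0`. [folklore] -/
theorem smul_ne_self_of_pow_three (h3 : ∀ a : A, a + a + a = 0) {τ : G} (hτ : ∀ a : A, a ≠ 0 → τ • a ≠ a)
    (a : A) (ha : a ≠ 0) : (τ ^ 3) • a ≠ a := by
  intro h
  have h' : τ • (τ • (τ • a)) = a := by
    have h'' := h
    rwa [pow_succ, pow_two, mul_smul, mul_smul] at h''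

  -- the norm element is fixed, hence zero
  have hfix2 : τ • (a + τ • a + τ • (τ • a)) = a + τ • a + τ • (τ • a) := by
    rw [smul_add, smul_add, h']; abel
  have he2 : a + τ • a + τ • (τ • a) = 0 := by
    by_contra hne
    exact hτ _ hne hfix2
  -- hence `τ a - a` is fixed, hence zero
  have hcc : τ • (τ • a) = -a - τ • a := by
    rw [eq_sub_iff_add_eq, eq_neg_iff_add_eq_zero, ← he2]; abel
  have hfix1 : τ • (τ • a - a) = τ • a - a := by
    rw [smul_sub, hcc]
    have h3b := h3 (τ • a)
    rw [sub_eq_iff_eq_add] -- -a - τ•a = τ•a - a + τ•a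
    have : τ • a - a + τ • a = -a - τ • a + (τ • a + τ • a + τ • a) := by abel
    rw [this, h3b, add_zero]
  have he1 : τ • a - a = 0 := by
    by_contra hne
    exact hτ _ hne hfix1
  exact hτ a ha (sub_eq_zero.mp he1)

/-- Hence every `τ^(3^j)` is fixed-point-free on such a group if `τ` is. [folklore] -/
theorem pow_three_pow_smul_ne_self (h3 : ∀ a : A, a + a + a = 0) {τ : G} (hτ : ∀ a : A, a ≠ 0 → τ • a ≠ a)
    (j : ℕ) : ∀ a : A, a ≠ 0 → (τ ^ (3 ^ j)) • a ≠ a := by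
  induction j with
  | zero => simpa using hτ
  | succ j ih =>
    intro a ha
    rw [pow_succ, pow_mul]
    exact smul_ne_self_of_pow_three h3 ih a ha

end ThreeTorsion

/-! ### §2  Over `𝔽₃`: determinant `−1` and no eigenvalue `1` force a fixed-point-free square -/

section MatrixThree

/-- Residue core (`decide`): for `a, b, c, d ∈ 𝔽₃` with `ad − bc = −1` such that `(a b; c d)` fixes no non-zero vector, the
square `(a² + bc, ab + bd; ca + dc, cb + d²)` fixes no non-zero vector either. [folklore] -/
theorem sq_fixedPointFree_of_det_eq_neg_one_zmod3 :
    ∀ a b c d : ZMod 3, a * d - b * c = -1 →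
      (∀ x y : ZMod 3, a * x + b * y = x → c * x + d * y = y → x = 0 ∧ y = 0) →
      ∀ x y : ZMod 3, (a * a + b * c) * x + (a * b + b * d) * y = x →
        (c * a + d * c) * x + (c * b + d * d) * y = y → x = 0 ∧ y = 0 := by
  decide

/-- `2 × 2` matrix-vector product in coordinates. [folklore] -/
theorem mulVec_fin_two (A : Matrix (Fin 2) (Fin 2) (ZMod 3)) (v : Fin 2 → ZMod 3) :
    A *ᵥ v = ![A 0 0 * v 0 + A 0 1 * v 1, A 1 0 * v 0 + A 1 1 * v 1] := by
  ext i
  fin_cases i <;> simp [Matrix.mulVec, dotProduct]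

/-- **A `2 × 2` matrix over `𝔽₃` of determinant `−1` without eigenvalue `1` has a fixed-point-free square.** (Its
characteristic polynomial `x² − tx − 1` has no root `±1` — a root `−1` would force the other root to be `1` — so its
eigenvalues have order `4` or `8` in `𝔽₉ˣ`.) [folklore] -/
theorem sq_mulVec_ne_of_det_eq_neg_one (A : Matrix (Fin 2) (Fin 2) (ZMod 3)) (hdet : A.det = -1)
    (hA : ∀ v : Fin 2 → ZMod 3, v ≠ 0 → A *ᵥ v ≠ v) :
    ∀ v : Fin 2 → ZMod 3, v ≠ 0 → (A * A) *ᵥ v ≠ v := by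
  intro v hv h
  rw [Matrix.det_fin_two] at hdet
  have hA' : ∀ x y : ZMod 3, A 0 0 * x + A 0 1 * y = x → A 1 0 * x + A 1 1 * y = y → x = 0 ∧ y = 0 := by
    intro x y h0 h1
    by_contra hne
    refine hA ![x, y] ?_ ?_
    · intro h0'
      apply hne
      exact ⟨by simpa using congrFun h0' 0, by simpa using congrFun h0' 1⟩
    · rw [mulVec_fin_two]
      ext i; fin_cases i <;> simp [h0, h1]
  rw [← Matrix.mulVec_mulVec, mulVec_fin_two, mulVec_fin_two] at h
  have h0 := congrFun h 0
  have h1 := congrFun h 1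
  simp only [Matrix.cons_val_zero, Matrix.cons_val_one] at h0 h1
  have key := sq_fixedPointFree_of_det_eq_neg_one_zmod3 (A 0 0) (A 0 1) (A 1 0) (A 1 1) hdet hA' (v 0) (v 1)
    (by linear_combination h0) (by linear_combination h1)
  apply hv
  ext i; fin_cases i
  · exact key.1
  · exact key.2

end MatrixThree

/-! ### §3  `a ≡ 1 (mod p) ⟹ a^{p^M} ≡ 1 (mod p^{M+1})` -/

/-- **Lifting the exponent, first step**: `a ≡ 1 (mod p) ⟹ a^{p^M} ≡ 1 (mod p^{M+1})` (Mathlib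
`dvd_sub_pow_of_dvd_sub`). [folklore] -/
theorem pow_prime_pow_modEq_one {p : ℕ} {a : ℕ} (ha : a ≡ 1 [MOD p]) (M : ℕ) :
    a ^ p ^ M ≡ 1 [MOD p ^ (M + 1)] := by
  have h : (p : ℤ) ∣ (a : ℤ) - 1 := by simpa using Nat.modEq_iff_dvd.mp ha.symm
  have key := dvd_sub_pow_of_dvd_sub h M
  rw [one_pow] at key
  refine (Nat.modEq_iff_dvd.mpr ?_).symm
  push_cast
  exact key

/-! ### §4  The Chebotarev argument for a globally minimal model -/

section Core

/-- The units of `𝔽₃` are `±1`. [folklore] -/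
private theorem units_zmod_three (u : (ZMod 3)ˣ) : u = 1 ∨ u = -1 := by
  fin_cases u <;> decide

/-- **Primes `ℓ ≡ 1 (mod 3^{M+1})` of good reduction, off any finite set, with `3 ∤ #W̃(𝔽_ℓ)`, when `W[3]` is irreducible**
(`W` globally minimal).  See the module docstring for the argument (Chebotarev in `ℚ(W[3^{M+1}])`, the element `σ = τ^k`
with `k ∈ {3^M, 2·3^M}` chosen by `det ρ̄₃(τ) = χ̄₃(τ) ∈ {1, −1}`). [cite: TateGCFT1967, §2.4 (Tchebotarev density theorem)]
[cite: Serre1972, §5.2 (iii)–(iv)] -/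
theorem exists_prime_modEq_one_not_three_dvd_reductionPointCount (W : WeierstrassCurve ℚ) [W.IsElliptic]
    [W.IsGloballyMinimal] (hirr : W.HasIrreducibleModPGaloisRep 3) (S : Finset ℕ) (M : ℕ) :
    ∃ (r : ℕ) (_ : Fact r.Prime), r ∉ S ∧ r ≠ 3 ∧ r ≡ 1 [MOD 3 ^ (M + 1)] ∧ W.HasGoodReductionAtPrime r ∧
      ¬ 3 ∣ W.reductionPointCount r := by
  classical
  haveI : Fact (Nat.Prime 3) := ⟨Nat.prime_three⟩
  haveI : NeZero (3 ^ (M + 1)) := ⟨pow_ne_zero _ three_ne_zero⟩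
  haveI : NeZero ((3 : ℕ) : ℚ) := ⟨by norm_num⟩
  have hq2 : 2 ≤ 3 ^ (M + 1) := by
    calc (2 : ℕ) ≤ 3 ^ 1 := by norm_num
      _ ≤ 3 ^ (M + 1) := Nat.pow_le_pow_right (by norm_num) (by omega)
  have hqpos : 0 < 3 ^ (M + 1) := by positivity
  -- (1) an element fixed-point-free on `W[3]`
  obtain ⟨τ, hτ⟩ : ∃ τ : absoluteGaloisGroup ℚ, ∀ P : W.geomTorsion ((3 : ℕ) : ℤ), P ≠ 0 → τ • P ≠ P := by
    by_contra h
    push Not at h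
    exact not_irreducible_of_forall_exists_smul_eq W 3 h hirr
  have h3 : ∀ P : W.geomTorsion ((3 : ℕ) : ℤ), P + P + P = 0 := by
    intro P
    have hP : ((3 : ℕ) : ℤ) • (P : W.geomPoints) = 0 := by
      simpa only [AddSubgroup.torsionBy, Submodule.mem_toAddSubgroup, Submodule.mem_torsionBy_iff] using P.2
    apply Subtype.ext
    show (P : W.geomPoints) + P + P = 0
    have e3 : (P : W.geomPoints) + P + P = (3 : ℤ) • (P : W.geomPoints) := by
      rw [show (3 : ℤ) = 1 + 1 + 1 by norm_num, add_zsmul, add_zsmul, one_zsmul]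
    rw [e3]
    exact_mod_cast hP
  -- (2) the frame `W[3] ≅ 𝔽₃²` and the matrix of `τ`
  obtain ⟨e, Φ, hframe, -, hdet, -, -⟩ := exists_frame_galoisRepTorsion_rat W 3
  set A : Matrix (Fin 2) (Fin 2) (ZMod 3) := ((Φ (galoisRepTorsion W ((3 : ℕ) : ℤ) τ) : GL (Fin 2) (ZMod 3)) :
    Matrix (Fin 2) (Fin 2) (ZMod 3)) with hAdef
  have hAe : ∀ P : W.geomTorsion ((3 : ℕ) : ℤ), e (τ • P) = A.mulVec (e P) := fun P ↦ by
    have h := hframe (galoisRepTorsion W ((3 : ℕ) : ℤ) τ) P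
    rwa [galoisRepTorsion_apply] at h
  have hA : ∀ v : Fin 2 → ZMod 3, v ≠ 0 → A.mulVec v ≠ v := by
    intro v hv h
    have hP : e.symm v ≠ 0 := fun h0 ↦ hv (by simpa using congrArg e h0)
    refine hτ (e.symm v) hP (e.injective ?_)
    rw [hAe, e.apply_symm_apply, h]
  have hdetτ : A.det = ((modPCyclotomicCharacterZMod ℚ 3 τ : (ZMod 3)ˣ) : ZMod 3) := by
    rw [hAdef, ← Matrix.GeneralLinearGroup.val_det_apply, hdet]
  -- (3) a primitive `3^{M+1}`-th root of unity fixed by the pointwise stabiliser of `W[3^{M+1}]`, and `τ ζ = ζ^a`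
  obtain ⟨ζ, hζ, hζfix⟩ := exists_isPrimitiveRoot_fixed (E := W) (q := 3 ^ (M + 1)) hq2
    (exists_geomTorsion_exactOrder_prime W Nat.prime_three M)
  have hτζq : (τ • ζ) ^ 3 ^ (M + 1) = 1 := by rw [← smul_pow', hζ.pow_eq_one, smul_one]
  obtain ⟨a, -, ha⟩ := hζ.eq_pow_of_pow_eq_one hτζq
  have hprim : IsPrimitiveRoot (τ • ζ) (3 ^ (M + 1)) :=
    hζ.map_of_injective (f := (show AlgebraicClosure ℚ ≃ₐ[ℚ] AlgebraicClosure ℚ from τ))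
      (show AlgebraicClosure ℚ ≃ₐ[ℚ] AlgebraicClosure ℚ from τ).injective
  rw [← ha] at hprim
  have hacop : a.Coprime (3 ^ (M + 1)) := (hζ.pow_iff_coprime hqpos a).mp hprim
  have ha0 : 0 < a := by
    rcases Nat.eq_zero_or_pos a with h0 | h0
    · rw [h0, Nat.coprime_zero_left] at hacop
      omega
    · exact h0
  have hpow : ∀ j : ℕ, (τ ^ j) • ζ = ζ ^ (a ^ j) := by
    intro j
    induction j with
    | zero => rw [pow_zero, one_smul, pow_zero, pow_one]
    | succ j ih => rw [pow_succ, mul_smul, ← ha, smul_pow', ih, ← pow_mul, ← pow_succ]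
  have hne : ζ ≠ 0 := hζ.ne_zero hqpos.ne'
  -- `ζ^{c} = ζ` as soon as `c ≡ 1 (mod 3^{M+1})`, `c ≥ 1`
  have hfixpow : ∀ c : ℕ, 1 ≤ c → c ≡ 1 [MOD 3 ^ (M + 1)] → ζ ^ c = ζ := by
    intro c hc hmod
    obtain ⟨d, hd⟩ := (Nat.modEq_iff_dvd' hc).mp hmod.symm
    have ec : c = 3 ^ (M + 1) * d + 1 := by omega
    rw [ec, pow_succ, pow_mul, hζ.pow_eq_one, one_pow, one_mul]
  -- (4) the exponent `k`: `σ := τ^k` is fixed-point-free on `W[3]` and fixes `ζ`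
  have key : ∃ k : ℕ, (∀ P : W.geomTorsion ((3 : ℕ) : ℤ), P ≠ 0 → (τ ^ k) • P ≠ P) ∧ (τ ^ k) • ζ = ζ := by
    rcases units_zmod_three (modPCyclotomicCharacterZMod ℚ 3 τ) with h1 | hm1
    · -- `det ρ̄₃(τ) = 1`: `τ` fixes `μ₃`, hence `a ≡ 1 (mod 3)`; take `k = 3^M`
      refine ⟨3 ^ M, pow_three_pow_smul_ne_self h3 hτ M, ?_⟩
      have hζ3 : (ζ ^ 3 ^ M) ^ 3 = 1 := by rw [← pow_mul, ← pow_succ, hζ.pow_eq_one]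
      have hτζ3 : τ • (ζ ^ 3 ^ M) = ζ ^ 3 ^ M := by
        rw [modPCyclotomicCharacterZMod_spec ℚ 3 τ _ hζ3, h1, Units.val_one, ZMod.val_one, pow_one]
      rw [smul_pow', ← ha, ← pow_mul] at hτζ3
      -- `ζ^{a 3^M} = ζ^{3^M}` ⟹ `3 ∣ a - 1`
      have h31 : ζ ^ (3 ^ M * (a - 1)) = 1 := by
        have e1 : a * 3 ^ M = 3 ^ M * (a - 1) + 3 ^ M := by
          zify [ha0]
          ring
        rw [e1, pow_add] at hτζ3
        exact (mul_eq_right₀ (pow_ne_zero _ hne)).mp hτζ3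
      have hdvd := (hζ.pow_eq_one_iff_dvd _).mp h31
      rw [pow_succ] at hdvd
      have h3a : 3 ∣ a - 1 := Nat.dvd_of_mul_dvd_mul_left (by positivity) hdvd
      have ha1 : a ≡ 1 [MOD 3] := ((Nat.modEq_iff_dvd' ha0).mpr h3a).symm
      rw [hpow]
      exact hfixpow _ (Nat.one_le_pow _ _ ha0) (pow_prime_pow_modEq_one ha1 M)
    · -- `det ρ̄₃(τ) = −1`: `τ²` is fixed-point-free; take `k = 2·3^M = φ(3^{M+1})`
      have hdet' : A.det = -1 := by rw [hdetτ, hm1, Units.val_neg, Units.val_one]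
      have hA2 := sq_mulVec_ne_of_det_eq_neg_one A hdet' hA
      have hAe2 : ∀ P : W.geomTorsion ((3 : ℕ) : ℤ), e ((τ ^ 2) • P) = (A * A).mulVec (e P) := fun P ↦ by
        have h := hframe (galoisRepTorsion W ((3 : ℕ) : ℤ) (τ ^ 2)) P
        rwa [galoisRepTorsion_apply, map_pow, map_pow, Units.val_pow_eq_pow_val, ← hAdef, pow_two A] at h
      have hτ2 : ∀ P : W.geomTorsion ((3 : ℕ) : ℤ), P ≠ 0 → (τ ^ 2) • P ≠ P := by
        intro P hP h
        have hv : e P ≠ 0 := fun h0 ↦ hP (e.injective (by simpa using h0))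
        exact hA2 (e P) hv (by rw [← hAe2, h])
      refine ⟨3 ^ M * 2, ?_, ?_⟩
      · intro P hP
        rw [mul_comm, pow_mul]
        exact pow_three_pow_smul_ne_self h3 hτ2 M P hP
      · rw [hpow]
        refine hfixpow _ (Nat.one_le_pow _ _ ha0) ?_
        have h1 : a ^ Nat.totient (3 ^ (M + 1)) ≡ 1 [MOD 3 ^ (M + 1)] := Nat.ModEq.pow_totient hacop
        have htot : Nat.totient (3 ^ (M + 1)) = 3 ^ M * 2 := by
          rw [Nat.totient_prime_pow Nat.prime_three (by omega : 0 < M + 1), Nat.add_sub_cancel]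
        rwa [htot] at h1
  obtain ⟨k, hσ, hσζ⟩ := key
  -- (5) Chebotarev off `S ∪ {3} ∪ {bad primes}`
  have hΔ0 : minimalDiscriminantInt W ≠ 0 := minimalDiscriminantInt_ne_zero W
  let S' : Set ℕ := {ℓ | ℓ = 3 ∨ (ℓ : ℤ) ∣ minimalDiscriminantInt W ∨ ℓ ∈ S}
  have hS' : S'.Finite := by
    refine ((Set.finite_le_nat (max 3 (minimalDiscriminantInt W).natAbs)).union
      (S : Set ℕ).toFinite).subset ?_
    rintro ℓ (rfl | hℓ | hℓ)
    · exact Or.inl (Set.mem_setOf.mpr (le_max_left _ _))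
    · exact Or.inl (Set.mem_setOf.mpr (le_max_of_le_right
        (Nat.le_of_dvd (Int.natAbs_pos.mpr hΔ0) (Int.natCast_dvd.mp hℓ))))
    · exact Or.inr hℓ
  obtain ⟨ℓ, v, 𝔓, φ, hℓ, hℓS, hv, h𝔓, hφ, hagree⟩ :=
    chebotarev_geomTorsion_holds W ((3 ^ (M + 1) : ℕ) : ℤ) (by exact_mod_cast hqpos.ne') S' hS' (τ ^ k)
  haveI : Fact ℓ.Prime := ⟨hℓ⟩
  have hℓ3 : ℓ ≠ 3 := fun h ↦ hℓS (Or.inl h)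
  have hℓΔ : ¬ (ℓ : ℤ) ∣ minimalDiscriminantInt W := fun h ↦ hℓS (Or.inr (Or.inl h))
  have hℓS₀ : ℓ ∉ S := fun h ↦ hℓS (Or.inr (Or.inr h))
  have hgood : W.HasGoodReductionAtPrime ℓ := hasGoodReductionAtPrime_of_not_dvd W ℓ hℓΔ
  -- (6) the Frobenius fixes `ζ`
  have hψ : ∀ T : W.geomTorsion ((3 ^ (M + 1) : ℕ) : ℤ), ((τ ^ k)⁻¹ * φ) • T = T := by
    intro T
    rw [mul_smul, hagree T, inv_smul_smul]
  have hφζ : φ • ζ = ζ := by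
    have h1 := hζfix _ hψ
    rw [mul_smul] at h1
    have h2' := congrArg (fun x ↦ (τ ^ k) • x) h1
    simp only [smul_inv_smul] at h2'
    rw [h2', hσζ]
  -- (7) `ℓ ≡ 1 (mod 3^{M+1})`
  have hfrob := frob_smul_eq_pow_of_pow_eq_one_prime (k := M + 1) hℓ Nat.prime_three hℓ3 hv h𝔓 hφ hζ.pow_eq_one
  have hℓ1 : ℓ ≡ 1 [MOD 3 ^ (M + 1)] := by
    have hz : ζ ^ ℓ = ζ := by rw [← hfrob, hφζ]
    have h1 : ζ ^ (ℓ - 1) = 1 := by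
      have : ζ ^ (ℓ - 1) * ζ = 1 * ζ := by
        rw [← pow_succ, Nat.sub_add_cancel hℓ.one_le, one_mul, hz]
      exact mul_right_cancel₀ hne this
    have hdvd := (hζ.pow_eq_one_iff_dvd (ℓ - 1)).mp h1
    exact ((Nat.modEq_iff_dvd' hℓ.one_le).mpr hdvd).symm
  -- (8) `3 ∤ #W̃(𝔽_ℓ)`: else the Frobenius fixes a non-zero point of `W[3]`
  refine ⟨ℓ, ⟨hℓ⟩, hℓS₀, hℓ3, hℓ1, hgood, fun hdvd3 ↦ ?_⟩
  obtain ⟨P, hP0, hP⟩ :=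
    exists_frobenius_smul_eq_of_dvd_reductionPointCount_holds W 3 ℓ hℓ3 hgood hdvd3 v hv 𝔓 h𝔓 φ hφ
  have hP3 : ((3 : ℕ) : ℤ) • (P : W.geomPoints) = 0 := by
    simpa only [AddSubgroup.torsionBy, Submodule.mem_toAddSubgroup, Submodule.mem_torsionBy_iff] using P.2
  have hPq : (P : W.geomPoints) ∈ W.geomTorsion ((3 ^ (M + 1) : ℕ) : ℤ) := by
    simp only [Submodule.mem_toAddSubgroup, Submodule.mem_torsionBy_iff]
    rw [Nat.cast_pow, pow_succ, mul_smul]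
    show ((3 : ℕ) : ℤ) ^ M • (((3 : ℕ) : ℤ) • (P : W.geomPoints)) = 0
    rw [hP3, smul_zero]
  have hval : φ • (P : W.geomPoints) = (τ ^ k) • (P : W.geomPoints) :=
    congrArg Subtype.val (hagree ⟨P, hPq⟩)
  apply hσ P hP0
  apply Subtype.ext
  rw [AddSubgroup.torsionBy.coe_smul, ← hval, ← AddSubgroup.torsionBy.coe_smul, hP]

end Core

/-! ### §5  E-es-40₃ -/

/-- **E-es-40₃ `NotTrivialEisensteinModThreeOfIrreducible` (es g19, MEMO-es §32; the `@[conjecture]` row of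
`NotTrivialEisensteinLocalisationThree`) is a THEOREM**: for an elliptic `W/ℚ` with `W[3]` irreducible, every finite `S` and
every `M`, some prime `r ∉ S` with `r ≡ 1 (mod 3^M)` has `a_r(W) ≢ r + 1 (mod 3)`.  Reduction to a global minimal model
(`hasGlobalMinimalModel_rat_holds`, `LFunction_smul`, `hasIrreducibleModPGaloisRep_smul_iff`, `LFunction_apply_prime_eq_frobeniusTrace`,
`dvd_frobeniusTrace_sub_iff`) and §1. [cite: TateGCFT1967, §2.4 (Tchebotarev density theorem)] -/
theorem notTrivialEisensteinModThreeOfIrreducible_holds : NotTrivialEisensteinModThreeOfIrreducible := by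
  intro W _ hirr S M
  classical
  obtain ⟨C, hC⟩ := WeierstrassCurve.hasGlobalMinimalModel_rat_holds W
  haveI := hC
  have hirr' : (C • W).HasIrreducibleModPGaloisRep 3 :=
    (Mazur1978.hasIrreducibleModPGaloisRep_smul_iff W C 3).mpr hirr
  obtain ⟨r, hr, hrS, _, hmod, hgood, hndvd⟩ :=
    exists_prime_modEq_one_not_three_dvd_reductionPointCount (C • W) hirr' S M
  refine ⟨r, hr.out, hrS, ?_, ?_⟩
  · rw [pow_succ'] at hmod
    exact Nat.ModEq.of_mul_left 3 hmod
  · rw [← WeierstrassCurve.LFunction_smul W C, WeierstrassCurve.LFunction_apply_prime_eq_frobeniusTrace (C • W) r hgood]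
    intro heq
    apply hndvd
    have h3 : ((((r : ℤ) + 1 : ℤ)) : ZMod 3) = (((C • W).frobeniusTrace r : ℤ) : ZMod 3) := by
      rw [heq]; push_cast; ring
    have h3' := (ZMod.intCast_eq_intCast_iff_dvd_sub ((r : ℤ) + 1) ((C • W).frobeniusTrace r) 3).mp h3
    exact (dvd_frobeniusTrace_sub_iff (C • W) 3 r).mp (by exact_mod_cast h3')

/-- **es's EDGE 2 without the binder `h40`** (PROVED): the generic cut of E-es-61 from E-es-69, E-es-69♮ and the residue
identification E-es-69♯ alone — `NotTrivialEisensteinModThreeOfIrreducible` is now supplied by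
`notTrivialEisensteinModThreeOfIrreducible_holds`. [cite: TateGCFT1967, §2.4 (Tchebotarev density theorem)] -/
theorem threeAdicUnitWitness_noMuThree_of_laws' (h69 : ThreeAdicWitnessOfNotTrivialEisenstein)
    (h69n : NotTrivialEisensteinModThreeMultiplicative)
    (h69s : NotTrivialEisensteinModThreeOfNoThreeTorsionOfNoMuThree) :
    ThreeAdicUnitWitnessOfNoRationalThreeTorsionOfNoMuThree :=
  threeAdicUnitWitness_noMuThree_of_laws h69 h69n h69s notTrivialEisensteinModThreeOfIrreducible_holds

end Summit.BirchSwinnertonDyer.BirchSwinnertonDyer.Theorems.ManinLocalTwoThree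

end
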